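import Literature.Algebra.Homology.OrderedCechSystemCupLeibniz
import HarnessLib

/-!
# The ordered Čech cup product, III: associativity
# (Godement, *Topologie algébrique et théorie des faisceaux*, II §6.6; Görtz–Wedhorn II (21.29); Stacks 01FP)

Sequel to `Algebra/Homology/OrderedCechSystemCup` (`cup β p q n`, the front-face/back-face cup product of ordered Čech
cochains of systems of `A`-modules along a pairing `β`, vertex-free form
`(f ∪ g)_σ = Σ_{v ∈ σ} β_σ (f.ext0At σ_{≤v} σ) (g.ext0At σ_{≥v} σ)`) and `…CupLeibniz` (the Leibniz rule).  THEOREMS ONLY: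

* **`cup_assoc`** — for four pairings `α : M × N → E`, `β : E × Q → R`, `γ : N × Q → G`, `δ : M × G → R` with
  `β(α(x,y),z) = δ(x,γ(y,z))` and `α`, `γ` natural: `(f ∪_α g) ∪_β h = f ∪_δ (g ∪_γ h)` ON COCHAINS (degrees `p + q = pq`,
  `q + r = qr`, any target degree).  Proof: both sides are the double sum over pairs of vertices `w ≤ v` of `σ` of
  `β(α(f_{σ≤w}, g_{σ∩[w,v]}), h_{σ≥v})`; the summands excluded by the degree conditions of `ext0At` vanish by the count
  `#σ_{≤w} + #(σ ∩ [w,v]) = #σ_{≤v} + 1`.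
Units for a system of algebras and graded commutativity in bidegree `(1,1)` are the sequel
`Algebra/Homology/OrderedCechSystemCupAlgebra`.

Everything here is proved; no definitions, no named facts.  Library only (cell hodgecm-mathlib, FLOOR-0 P1 F-11 road A,
jobs J3/J4-(iv)); HC_CM is proved only modulo the 7 printed citations until rung 0 closes, and nothing here bears on it.

## References

* [Godement1958] R. Godement, *Topologie algébrique et théorie des faisceaux*, Hermann (1958), II §6.6.
* [GortzWedhorn2023] U. Görtz, T. Wedhorn, *Algebraic Geometry II: Cohomology of Schemes* (2023), Def. 21.68, (21.29).
* [StacksProject] The Stacks Project, Tag 01FP.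
-/

universe v u

open CategoryTheory

set_option backward.isDefEq.respectTransparency false

noncomputable section

namespace Literature.Algebra.Homology

namespace OrderedCech

variable {ι : Type} [LinearOrder ι]

/-! ### Intervals inside a finite set: `σ ∩ [w, v]` and the vertex counts -/

section Intervals

/-- The lower cut of a lower cut: `(s_{≤v})_{≤w} = s_{≤w}` for `w ≤ v`.
[folklore] [cite: GortzWedhorn2023, Def. 21.68 (p. 180)] -/
theorem filter_le_filter_le_of_le (s : Finset ι) {w v : ι} (hwv : w ≤ v) :
    (s.filter (· ≤ v)).filter (· ≤ w) = s.filter (· ≤ w) := by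
  ext b
  simp only [Finset.mem_filter]
  exact ⟨fun h => ⟨h.1.1, h.2⟩, fun h => ⟨⟨h.1, h.2.trans hwv⟩, h.2⟩⟩

/-- The upper cut of an upper cut: `(s_{≥w})_{≥v} = s_{≥v}` for `w ≤ v`.
[folklore] [cite: GortzWedhorn2023, Def. 21.68 (p. 180)] -/
theorem filter_ge_filter_ge_of_le (s : Finset ι) {w v : ι} (hwv : w ≤ v) :
    (s.filter (w ≤ ·)).filter (v ≤ ·) = s.filter (v ≤ ·) := by
  ext b
  simp only [Finset.mem_filter]
  exact ⟨fun h => ⟨h.1.1, h.2⟩, fun h => ⟨⟨h.1, hwv.trans h.2⟩, h.2⟩⟩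

/-- The two descriptions of the interval `σ ∩ [w, v]`: `(s_{≤v})_{≥w} = (s_{≥w})_{≤v}`.
[folklore] [cite: GortzWedhorn2023, Def. 21.68 (p. 180)] -/
theorem filter_le_filter_ge_comm (s : Finset ι) (w v : ι) :
    (s.filter (· ≤ v)).filter (w ≤ ·) = (s.filter (w ≤ ·)).filter (· ≤ v) := by
  ext b
  simp only [Finset.mem_filter]
  exact ⟨fun h => ⟨⟨h.1.1, h.2⟩, h.1.2⟩, fun h => ⟨⟨h.1.1, h.2⟩, h.1.2⟩⟩

/-- **Vertex count of a front face split at `w`**: for `w ∈ s`, `w ≤ v`,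
`#s_{≤w} + #(s ∩ [w,v]) = #s_{≤v} + 1` (the two pieces cover `s_{≤v}` and meet in `{w}`).
[folklore] [cite: GortzWedhorn2023, Def. 21.68 (p. 180)] -/
theorem card_filter_le_add_card_interval (s : Finset ι) {w v : ι} (hw : w ∈ s) (hwv : w ≤ v) :
    (s.filter (· ≤ w)).card + ((s.filter (· ≤ v)).filter (w ≤ ·)).card = (s.filter (· ≤ v)).card + 1 := by
  classical
  have hunion : s.filter (· ≤ w) ∪ (s.filter (· ≤ v)).filter (w ≤ ·) = s.filter (· ≤ v) := by
    ext b
    simp only [Finset.mem_union, Finset.mem_filter]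
    constructor
    · rintro (⟨hb, hbw⟩ | ⟨⟨hb, hbv⟩, _⟩)
      · exact ⟨hb, hbw.trans hwv⟩
      · exact ⟨hb, hbv⟩
    · rintro ⟨hb, hbv⟩
      rcases le_or_gt b w with h | h
      · exact Or.inl ⟨hb, h⟩
      · exact Or.inr ⟨⟨hb, hbv⟩, le_of_lt h⟩
  have hinter : s.filter (· ≤ w) ∩ (s.filter (· ≤ v)).filter (w ≤ ·) = {w} := by
    ext b
    simp only [Finset.mem_inter, Finset.mem_filter, Finset.mem_singleton]
    constructor
    · rintro ⟨⟨_, hbw⟩, ⟨_, hwb⟩⟩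
      exact le_antisymm hbw hwb
    · rintro rfl
      exact ⟨⟨hw, le_rfl⟩, ⟨⟨hw, hwv⟩, le_rfl⟩⟩
  have h := Finset.card_union_add_card_inter (s.filter (· ≤ w)) ((s.filter (· ≤ v)).filter (w ≤ ·))
  rw [hunion, hinter, Finset.card_singleton] at h
  exact h.symm

/-- **Vertex count of a back face split at `v`**: for `v ∈ s`, `w ≤ v`,
`#(s ∩ [w,v]) + #s_{≥v} = #s_{≥w} + 1`. [folklore] [cite: GortzWedhorn2023, Def. 21.68 (p. 180)] -/
theorem card_interval_add_card_filter_ge (s : Finset ι) {w v : ι} (hv : v ∈ s) (hwv : w ≤ v) :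
    ((s.filter (w ≤ ·)).filter (· ≤ v)).card + (s.filter (v ≤ ·)).card = (s.filter (w ≤ ·)).card + 1 := by
  classical
  have hunion : (s.filter (w ≤ ·)).filter (· ≤ v) ∪ s.filter (v ≤ ·) = s.filter (w ≤ ·) := by
    ext b
    simp only [Finset.mem_union, Finset.mem_filter]
    constructor
    · rintro (⟨⟨hb, hwb⟩, _⟩ | ⟨hb, hvb⟩)
      · exact ⟨hb, hwb⟩
      · exact ⟨hb, hwv.trans hvb⟩
    · rintro ⟨hb, hwb⟩
      rcases le_or_gt b v with h | h
      · exact Or.inl ⟨⟨hb, hwb⟩, h⟩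
      · exact Or.inr ⟨hb, le_of_lt h⟩
  have hinter : (s.filter (w ≤ ·)).filter (· ≤ v) ∩ s.filter (v ≤ ·) = {v} := by
    ext b
    simp only [Finset.mem_inter, Finset.mem_filter, Finset.mem_singleton]
    constructor
    · rintro ⟨⟨_, hbv⟩, ⟨_, hvb⟩⟩
      exact le_antisymm hbv hvb
    · rintro rfl
      exact ⟨⟨⟨hv, hwv⟩, le_rfl⟩, ⟨hv, le_rfl⟩⟩
  have h := Finset.card_union_add_card_inter ((s.filter (w ≤ ·)).filter (· ≤ v)) (s.filter (v ≤ ·))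
  rw [hunion, hinter, Finset.card_singleton] at h
  exact h.symm

end Intervals

/-! ### Associativity -/

section Assoc

variable {A : Type u} [CommRing A] {M N E Q G R : Finset ι ⥤ ModuleCat.{v} A}
  {α : ∀ s : Finset ι, M.obj s →ₗ[A] N.obj s →ₗ[A] E.obj s}
  {β : ∀ s : Finset ι, E.obj s →ₗ[A] Q.obj s →ₗ[A] R.obj s}
  {γ : ∀ s : Finset ι, N.obj s →ₗ[A] Q.obj s →ₗ[A] G.obj s}
  {δ : ∀ s : Finset ι, M.obj s →ₗ[A] G.obj s →ₗ[A] R.obj s}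

/-- The inner sum of `(f ∪ g) ∪ h` at the cut `v`: `(f ∪_α g).ext0At s_{≤v} s = Σ_{w ∈ s_{≤v}} α_s(f.ext0At s_{≤w} s,
g.ext0At (s ∩ [w,v]) s)` — by `ext0At_cup` when `s_{≤v}` has `p + q + 1` vertices, and `0 = 0` termwise otherwise.
[cite: Godement1958, II §6.6] -/
theorem ext0At_cup_filter_le (hα : IsNaturalPairing α) {p q pq : ℤ} (hpq : p + q = pq) (f : SysCochain M p)
    (g : SysCochain N q) (s : Finset ι) {v : ι} (hv : v ∈ s) :
    (cup α p q pq f g).ext0At (s.filter (· ≤ v)) s =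
      ∑ w ∈ s.filter (· ≤ v),
        α s (f.ext0At (s.filter (· ≤ w)) s) (g.ext0At ((s.filter (· ≤ v)).filter (w ≤ ·)) s) := by
  have hne : (s.filter (· ≤ v)).Nonempty := ⟨v, Finset.mem_filter.2 ⟨hv, le_rfl⟩⟩
  by_cases hc : ((s.filter (· ≤ v)).card : ℤ) = pq + 1
  · rw [ext0At_cup hα f g _ s ⟨hne, hc⟩ (Finset.filter_subset _ _)]
    refine Finset.sum_congr rfl fun w hw => ?_
    rw [filter_le_filter_le_of_le s (Finset.mem_filter.1 hw).2]
  · have hz : (cup α p q pq f g).ext0At (s.filter (· ≤ v)) s = 0 := by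
      unfold SysCochain.ext0At
      rw [dif_neg]
      exact fun h => hc h.1.2
    rw [hz, eq_comm]
    refine Finset.sum_eq_zero fun w hw => ?_
    obtain ⟨hws, hwv⟩ := Finset.mem_filter.1 hw
    by_cases h1 : ((s.filter (· ≤ w)).card : ℤ) = p + 1
    · have h2 : ¬ ((((s.filter (· ≤ v)).filter (w ≤ ·)).card : ℤ) = q + 1) := by
        intro h2
        have hcnt := card_filter_le_add_card_interval s hws hwv
        apply hc
        omega
      rw [ext0At_upperCut_eq_zero g _ s w h2, map_zero]
    · rw [ext0At_lowerCut_eq_zero f s s w h1, map_zero, LinearMap.zero_apply]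

/-- The inner sum of `f ∪ (g ∪ h)` at the cut `w`: `(g ∪_γ h).ext0At s_{≥w} s = Σ_{v ∈ s_{≥w}} γ_s(g.ext0At (s ∩ [w,v]) s,
h.ext0At s_{≥v} s)`. [cite: Godement1958, II §6.6] -/
theorem ext0At_cup_filter_ge (hγ : IsNaturalPairing γ) {q r qr : ℤ} (hqr : q + r = qr) (g : SysCochain N q)
    (h : SysCochain Q r) (s : Finset ι) {w : ι} (hw : w ∈ s) :
    (cup γ q r qr g h).ext0At (s.filter (w ≤ ·)) s =
      ∑ v ∈ s.filter (w ≤ ·),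
        γ s (g.ext0At ((s.filter (w ≤ ·)).filter (· ≤ v)) s) (h.ext0At (s.filter (v ≤ ·)) s) := by
  have hne : (s.filter (w ≤ ·)).Nonempty := ⟨w, Finset.mem_filter.2 ⟨hw, le_rfl⟩⟩
  by_cases hc : ((s.filter (w ≤ ·)).card : ℤ) = qr + 1
  · rw [ext0At_cup hγ g h _ s ⟨hne, hc⟩ (Finset.filter_subset _ _)]
    refine Finset.sum_congr rfl fun v hv => ?_
    rw [filter_ge_filter_ge_of_le s (Finset.mem_filter.1 hv).2]
  · have hz : (cup γ q r qr g h).ext0At (s.filter (w ≤ ·)) s = 0 := by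
      unfold SysCochain.ext0At
      rw [dif_neg]
      exact fun h' => hc h'.1.2
    rw [hz, eq_comm]
    refine Finset.sum_eq_zero fun v hv => ?_
    obtain ⟨hvs, hwv⟩ := Finset.mem_filter.1 hv
    by_cases h1 : ((s.filter (v ≤ ·)).card : ℤ) = r + 1
    · have h2 : ¬ ((((s.filter (w ≤ ·)).filter (· ≤ v)).card : ℤ) = q + 1) := by
        intro h2
        have hcnt := card_interval_add_card_filter_ge s hvs hwv
        apply hc
        omega
      have : g.ext0At ((s.filter (w ≤ ·)).filter (· ≤ v)) s = 0 := by
        unfold SysCochain.ext0At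
        rw [dif_neg]
        exact fun h' => h2 h'.1.2
      rw [this, map_zero, LinearMap.zero_apply]
    · rw [ext0At_upperCut_eq_zero h s s v h1, map_zero]

/-- **Associativity of the cup product on cochains.**  For pairings `α : M × N → E`, `β : E × Q → R`, `γ : N × Q → G`,
`δ : M × G → R` with `β(α(x,y),z) = δ(x,γ(y,z))`, `α` and `γ` natural, and degrees `p + q = pq`, `q + r = qr`:
`(f ∪_α g) ∪_β h = f ∪_δ (g ∪_γ h)` in `Čⁿ(R)`. [cite: Godement1958, II §6.6] [cite: GortzWedhorn2023, (21.29)] -/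
theorem cup_assoc (hα : IsNaturalPairing α) (hγ : IsNaturalPairing γ)
    (compat : ∀ (s : Finset ι) (x : M.obj s) (y : N.obj s) (z : Q.obj s), β s (α s x y) z = δ s x (γ s y z))
    {p q r pq qr n : ℤ} (hpq : p + q = pq) (hqr : q + r = qr)
    (f : SysCochain M p) (g : SysCochain N q) (h : SysCochain Q r) :
    cup β pq r n (cup α p q pq f g) h = cup δ p qr n f (cup γ q r qr g h) := by
  funext σ
  set S : Finset ι := σ.1 with hS
  rw [cup_apply, cup_apply]
  -- expand both sides into double sums over pairs `w ≤ v`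
  have hL : ∀ v ∈ S, β S ((cup α p q pq f g).ext0At (S.filter (· ≤ v)) S) (h.ext0At (S.filter (v ≤ ·)) S) =
      ∑ w ∈ S.filter (· ≤ v), β S (α S (f.ext0At (S.filter (· ≤ w)) S)
        (g.ext0At ((S.filter (· ≤ v)).filter (w ≤ ·)) S)) (h.ext0At (S.filter (v ≤ ·)) S) := by
    intro v hv
    rw [ext0At_cup_filter_le hα hpq f g S hv, map_sum, LinearMap.sum_apply]
  have hR : ∀ w ∈ S, δ S (f.ext0At (S.filter (· ≤ w)) S) ((cup γ q r qr g h).ext0At (S.filter (w ≤ ·)) S) =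
      ∑ v ∈ S.filter (w ≤ ·), δ S (f.ext0At (S.filter (· ≤ w)) S)
        (γ S (g.ext0At ((S.filter (w ≤ ·)).filter (· ≤ v)) S) (h.ext0At (S.filter (v ≤ ·)) S)) := by
    intro w hw
    rw [ext0At_cup_filter_ge hγ hqr g h S hw, map_sum]
  rw [Finset.sum_congr rfl hL, Finset.sum_congr rfl hR]
  -- swap the order of summation and compare termwise
  rw [Finset.sum_comm' (t' := S) (s' := fun w => S.filter (w ≤ ·))]
  · refine Finset.sum_congr rfl fun w _ => Finset.sum_congr rfl fun v _ => ?_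
    rw [compat, filter_le_filter_ge_comm]
  · intro v w
    simp only [Finset.mem_filter]
    constructor
    · rintro ⟨hv, hw, hwv⟩
      exact ⟨⟨hv, hwv⟩, hw⟩
    · rintro ⟨⟨hv, hwv⟩, hw⟩
      exact ⟨hv, hw, hwv⟩

end Assoc

end OrderedCech

end Literature.Algebra.Homology

end
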